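import Summits.Ventures.WeilGRH.TwistedGramCellCheck
import HarnessLib

/-!
# GRH arm (rh-explicit, venture WeilGRH): twisted format C — the SMALL-CELL checker, even sector, far-diagonal SIGN facts
  (brick (E3a) of the χ instance lane: `h0e`, `hd0e`, `hwe` of the door from interval boxes)

Cell `rh-explicit`, WEIL TRACK — GRH ARM (engine seat weil-grh-2 gen7).  Sequel of `TwistedGramCellCheck.lean` (E2): the
door `weilPositivityOnChar_of_twisted_formatC_data` also asks, per sector, for the sign facts of the far diagonal
`d̂⁺_χ(m) = (Re ψ(¼+iω_m/2) − log π + log q)/2 − C/(π²m²) − 1/(8m) − (C/π²)√(8/(B−1)) − A_op⁺/2` (`C = a(1+E(2a))`):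
`h0e : 0 < d̂⁺(B)`, `hd0e : 0 < d₀ ≤ d̂⁺(B₃)`, `hwe : 0 < w_m ≤ d̂⁺(m)` on `[B, B₃)`.  Here: the box `dhatEBox` of the LOWER
diagonal `d̂′⁺ ≤ d̂⁺` (the irrational `√(8/(B−1))` replaced by a checked rational `r₈ ≥` it), the integer comparisons
`checkSignsE`, and ★ `signsE_of_checkSignsE` delivering the three facts LITERALLY in the door's shape, given boxes
`CC ∋ a(1+E(2a))` and `AOP ∋ A_op⁺(a)` (their kernel construction = brick (E3b)).  Everything is PROVED; computable `def`s;
no named facts; RH/GRH-free.  References: H. Yoshida (1992) §7 [Yoshida1992HermitianForms]; R. E. Moore (1966) Ch. 3 [Moore1966].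
-/

set_option autoImplicit false

open Real Complex Finset
open scoped BigOperators ArithmeticFunction.vonMangoldt

namespace Summit.Ventures.WeilGRH

open Literature.NumberTheory.LFunctions Literature.NumberTheory.LFunctions.Yoshida1992
open Literature.NumberTheory.LFunctions.Yoshida1992.Encl
open Literature.Analysis.SpecialFunctions Literature.Analysis.ValidatedNumerics.NumericsMP

namespace TwistedEncl

variable {S : ℕ} {a : ℝ} {q : ℕ}

/-! ## The far-diagonal sign facts `h0e`, `hd0e`, `hwe` -/

/-- Box of the LOWER far diagonal `d̂′⁺(m) = (Re ψ(¼+iω_m/2) − log π + log q)/2 − C/(π²m²) − 1/(8m) − (C/π²)·r₈ − A_op⁺/2`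
(`r₈ = r8N/r8D ≥ √(8/(B−1))`, so `d̂′⁺ ≤ d̂⁺` of the door). [cite: Yoshida1992HermitianForms, §7 pp. 305–312] -/
def dhatEBox (S : ℕ) (C : Consts) (LQ : MI) (tab : List IdxRec) (d : EvenCellData) (m : ℕ) : MI :=
  let cpi := (d.CC.mul S C.invPi).mul S C.invPi
  (((((((tget tab m).reP.sub C.logPi).add LQ).divNat 2).sub (cpi.divNat (m * m))).sub (MI.ofFrac S 1 (8 * m))).sub
    ((cpi.mulInt d.r8N).divNat d.r8D)).sub (d.AOP.divNat 2)

/-- The real lower far diagonal `d̂′⁺(m)`. [cite: Yoshida1992HermitianForms, §7 pp. 305–312] -/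
noncomputable def dhatELow (a Lq Cc Aop r8 : ℝ) (m : ℕ) : ℝ :=
  (reDigammaQuarter (freq a m) - Real.log π + Lq) / 2 - Cc / π ^ 2 / ((m : ℝ) * m) - 1 / (8 * (m : ℝ)) -
    Cc / π ^ 2 * r8 - Aop / 2

/-- Soundness of `dhatEBox` (`1 ≤ m < N`). [cite: Moore1966, Ch. 3 (interval arithmetic: inclusion property)] -/
theorem mem_dhatEBox (hS : 0 < S) {ks : List PrimeLen} {C : Consts} (hC : ConstsValid S a ks C) {LQ : MI} {Lq : ℝ}
    (hLQ : MI.mem S Lq LQ) {N : ℕ} {tab : List IdxRec} (hT : TabValid S a ks N tab) {d : EvenCellData} {Cc Aop : ℝ}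
    (hCC : MI.mem S Cc d.CC) (hAOP : MI.mem S Aop d.AOP) (hr8D : 0 < d.r8D) {m : ℕ} (hm1 : 1 ≤ m) (hm : m < N) :
    MI.mem S (dhatELow a Lq Cc Aop ((d.r8N : ℝ) / d.r8D) m) (dhatEBox S C LQ tab d m) := by
  unfold dhatEBox dhatELow
  have hcpi : MI.mem S (Cc / π ^ 2) ((d.CC.mul S C.invPi).mul S C.invPi) := by
    refine mem_of_eq (MI.mem_mul hS (MI.mem_mul hS hCC hC.invPi) hC.invPi) ?_
    field_simp
  have hreP := (hT m hm).2.reP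
  have h := MI.mem_sub (MI.mem_sub (MI.mem_sub (MI.mem_sub (MI.mem_divNat (MI.mem_add (MI.mem_sub hreP hC.logPi) hLQ)
    (n := 2) (by norm_num)) (MI.mem_divNat hcpi (n := m * m) (Nat.mul_pos hm1 hm1)))
    (MI.mem_ofFrac S 1 (q := 8 * m) (by omega))) (MI.mem_divNat (MI.mem_mulInt hcpi d.r8N) hr8D))
    (MI.mem_divNat hAOP (n := 2) (by norm_num))
  refine mem_of_eq h ?_
  push_cast
  ring

/-- `d̂′⁺(m) ≤ d̂⁺(m)`: replacing `√(8/(B−1))` by a rational `r₈ ≥` it only lowers the diagonal (`C ≥ 0`).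
[cite: Yoshida1992HermitianForms, §7 pp. 305–312] -/
theorem dhatELow_le {Lq Cc Aop r8 : ℝ} (hCc : 0 ≤ Cc) {B : ℕ} (hr8 : Real.sqrt (8 / ((B - 1 : ℕ) : ℝ)) ≤ r8) (m : ℕ) :
    dhatELow a Lq Cc Aop r8 m ≤
      (reDigammaQuarter (freq a m) - Real.log π + Lq) / 2 - Cc / (π ^ 2 * m ^ 2) - 1 / (8 * m) -
        Cc / π ^ 2 * Real.sqrt (8 / ((B - 1 : ℕ) : ℝ)) - Aop / 2 := by
  unfold dhatELow
  have hπ : 0 < π ^ 2 := by positivity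
  have h1 : Cc / π ^ 2 * Real.sqrt (8 / ((B - 1 : ℕ) : ℝ)) ≤ Cc / π ^ 2 * r8 :=
    mul_le_mul_of_nonneg_left hr8 (div_nonneg hCc hπ.le)
  have h2 : Cc / π ^ 2 / ((m : ℝ) * m) = Cc / (π ^ 2 * m ^ 2) := by rw [div_div]; ring
  rw [h2]
  linarith

/-- The sign checks of the even sector: `r₈² ≥ 8/(B−1)` (so `r₈ ≥ √(8/(B−1))`), `d̂′⁺(B) > 0`, `d₀ ≤ d̂′⁺(B₃)`,
`w_{B+c} ≤ d̂′⁺(B+c)` for `c < B₃ − B` — integer comparisons on the boxes. [cite: Moore1966, Ch. 3 (interval arithmetic: inclusion property)] -/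
def checkSignsE (S : ℕ) (C : Consts) (LQ : MI) (tab : List IdxRec) (d : EvenCellData) : Bool :=
  decide (2 ≤ d.B) && decide (2 * d.B ≤ d.B3) && decide (0 < d.r8D) && decide (0 < d.d0N) &&
    decide (8 * d.r8D ^ 2 ≤ (d.B - 1) * d.r8N ^ 2) &&
    decide (0 < (dhatEBox S C LQ tab d d.B).lo) &&
    decide ((d.d0N : ℤ) * S ≤ (dhatEBox S C LQ tab d d.B3).lo * 2 ^ d.wbits) &&
    (List.range (d.B3 - d.B)).all fun c ↦ decide (0 < d.wN.getD c 0) &&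
      decide ((d.wN.getD c 0 : ℤ) * S ≤ (dhatEBox S C LQ tab d (d.B + c)).lo * 2 ^ d.wbits)

/-- ★ **The door's even-sector sign facts from checked boxes**: `checkSignsE = true`, valid constants / table below
`N > B₃` / boxes `LQ ∋ log q`, `CC ∋ a(1 + weilArchDensity(2a))`, `AOP ∋ A_op⁺(a)` ⇒ `h0e`, `hd0e`, `hwe` of
`weilPositivityOnChar_of_twisted_formatC_data` with `d₀ = d0N·2^{−wbits}`, `w_m = wN_{m−B}·2^{−wbits}`.
[cite: Yoshida1992HermitianForms, §7 pp. 305–312] -/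
theorem signsE_of_checkSignsE (hS : 0 < S) (ha0 : 0 < a) {ks : List PrimeLen} {C : Consts}
    (hC : ConstsValid S a ks C) {LQ : MI} (hLQ : MI.mem S (Real.log q) LQ) {N : ℕ} {tab : List IdxRec}
    (hT : TabValid S a ks N tab) {d : EvenCellData} (hN : d.B3 < N)
    (hCC : MI.mem S (a * (1 + weilArchDensity (2 * a))) d.CC)
    (hAOP : MI.mem S (∑ k ∈ weilPrimeIndex a, (Λ k : ℝ) / Real.sqrt k * (2 * Real.cos (π / (⌊2 * a / Real.log k⌋₊ + 2)))) d.AOP)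
    (h : checkSignsE S C LQ tab d = true) :
    (0 < ((reDigammaQuarter (freq a d.B) - Real.log π + Real.log q) / 2 - a * (1 + weilArchDensity (2 * a)) / (π ^ 2 * d.B ^ 2) - 1 / (8 * d.B) - a * (1 + weilArchDensity (2 * a)) / π ^ 2 * Real.sqrt (8 / ((d.B - 1 : ℕ) : ℝ)) - (∑ k ∈ weilPrimeIndex a, (Λ k : ℝ) / Real.sqrt k * (2 * Real.cos (π / (⌊2 * a / Real.log k⌋₊ + 2)))) / 2)) ∧
    (0 < (d.d0N : ℝ) / 2 ^ d.wbits ∧ (d.d0N : ℝ) / 2 ^ d.wbits ≤ ((reDigammaQuarter (freq a d.B3) - Real.log π + Real.log q) / 2 - a * (1 + weilArchDensity (2 * a)) / (π ^ 2 * d.B3 ^ 2) - 1 / (8 * d.B3) - a * (1 + weilArchDensity (2 * a)) / π ^ 2 * Real.sqrt (8 / ((d.B - 1 : ℕ) : ℝ)) - (∑ k ∈ weilPrimeIndex a, (Λ k : ℝ) / Real.sqrt k * (2 * Real.cos (π / (⌊2 * a / Real.log k⌋₊ + 2)))) / 2)) ∧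
    (∀ m, d.B ≤ m → m < d.B3 → 0 < (d.wN.getD (m - d.B) 0 : ℝ) / 2 ^ d.wbits ∧ (d.wN.getD (m - d.B) 0 : ℝ) / 2 ^ d.wbits ≤ ((reDigammaQuarter (freq a m) - Real.log π + Real.log q) / 2 - a * (1 + weilArchDensity (2 * a)) / (π ^ 2 * m ^ 2) - 1 / (8 * m) - a * (1 + weilArchDensity (2 * a)) / π ^ 2 * Real.sqrt (8 / ((d.B - 1 : ℕ) : ℝ)) - (∑ k ∈ weilPrimeIndex a, (Λ k : ℝ) / Real.sqrt k * (2 * Real.cos (π / (⌊2 * a / Real.log k⌋₊ + 2)))) / 2)) := by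
  unfold checkSignsE at h
  simp only [Bool.and_eq_true, decide_eq_true_eq, List.all_eq_true, List.mem_range] at h
  obtain ⟨⟨⟨⟨⟨⟨⟨hB2, hBB3⟩, hr8D⟩, hd0N⟩, hr8⟩, h0⟩, hd0⟩, hw⟩ := h
  set Cc := a * (1 + weilArchDensity (2 * a)) with hCc
  set Aop := ∑ k ∈ weilPrimeIndex a, (Λ k : ℝ) / Real.sqrt k * (2 * Real.cos (π / (⌊2 * a / Real.log k⌋₊ + 2))) with hAop
  have hCc0 : 0 ≤ Cc := by
    have hE : 0 < weilArchDensity (2 * a) := weilArchDensity_pos (by positivity)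
    positivity
  -- `√(8/(B−1)) ≤ r₈`
  have hr8' : Real.sqrt (8 / ((d.B - 1 : ℕ) : ℝ)) ≤ (d.r8N : ℝ) / d.r8D := by
    have hB1 : (0 : ℝ) < ((d.B - 1 : ℕ) : ℝ) := by exact_mod_cast (show 0 < d.B - 1 by omega)
    have hrD : (0 : ℝ) < d.r8D := by exact_mod_cast hr8D
    have hq : (8 : ℝ) / ((d.B - 1 : ℕ) : ℝ) ≤ ((d.r8N : ℝ) / d.r8D) ^ 2 := by
      have h' : (8 : ℝ) * (d.r8D : ℝ) ^ 2 ≤ ((d.B - 1 : ℕ) : ℝ) * (d.r8N : ℝ) ^ 2 := by exact_mod_cast hr8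
      rw [div_pow, div_le_div_iff₀ hB1 (by positivity)]
      linarith
    calc Real.sqrt (8 / ((d.B - 1 : ℕ) : ℝ)) ≤ Real.sqrt (((d.r8N : ℝ) / d.r8D) ^ 2) := Real.sqrt_le_sqrt hq
      _ = (d.r8N : ℝ) / d.r8D := Real.sqrt_sq (by positivity)
  have hSr : (0 : ℝ) < S := by exact_mod_cast hS
  -- generic step: box at m
  have step : ∀ m, 1 ≤ m → m < N →
      ((dhatEBox S C LQ tab d m).lo : ℝ) ≤ S * ((reDigammaQuarter (freq a m) - Real.log π + Real.log q) / 2 -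
        Cc / (π ^ 2 * m ^ 2) - 1 / (8 * m) - Cc / π ^ 2 * Real.sqrt (8 / ((d.B - 1 : ℕ) : ℝ)) - Aop / 2) := by
    intro m hm1 hmN
    have hmem := mem_dhatEBox hS hC hLQ hT hCC hAOP hr8D hm1 hmN
    have hle := dhatELow_le (a := a) (Lq := Real.log q) (Aop := Aop) hCc0 hr8' m
    have := hmem.1
    nlinarith
  refine ⟨?_, ⟨by positivity, ?_⟩, fun m hBm hmB3 ↦ ⟨?_, ?_⟩⟩
  · have h1 := step d.B (by omega) (by omega)
    have h0' : (0 : ℝ) < (dhatEBox S C LQ tab d d.B).lo := by exact_mod_cast h0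
    have h3 := lt_of_lt_of_le h0' h1
    rcases pos_and_pos_or_neg_and_neg_of_mul_pos h3 with ⟨_, h⟩ | ⟨h, _⟩
    · exact h
    · exact absurd h (not_lt.2 hSr.le)
  · have h1 := step d.B3 (by omega) hN
    have hd0' : ((d.d0N : ℤ) : ℝ) * S ≤ ((dhatEBox S C LQ tab d d.B3).lo : ℝ) * 2 ^ d.wbits := by exact_mod_cast hd0
    have h2 : (0 : ℝ) < 2 ^ d.wbits := by positivity
    rw [div_le_iff₀ h2]
    push_cast at hd0'
    nlinarith
  · have := (hw (m - d.B) (by omega)).1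
    positivity
  · have h1 := step m (by omega) (by omega)
    have hw' := (hw (m - d.B) (by omega)).2
    rw [show d.B + (m - d.B) = m by omega] at hw'
    have hw'' : ((d.wN.getD (m - d.B) 0 : ℤ) : ℝ) * S ≤ ((dhatEBox S C LQ tab d m).lo : ℝ) * 2 ^ d.wbits := by
      exact_mod_cast hw'
    have h2 : (0 : ℝ) < 2 ^ d.wbits := by positivity
    rw [div_le_iff₀ h2]
    push_cast at hw''
    nlinarith

end TwistedEncl

end Summit.Ventures.WeilGRH
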